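import Summits.BirchSwinnertonDyer.BirchSwinnertonDyer.Theorems.QuadraticBranchSignedControlPlusEtaNonsurjThetaFunctionalEquationReciprocityIdeal
import Mathlib.NumberTheory.Padics.Hensel
import HarnessLib

/-!
# Route `QuadraticBranchSignedControl` (rung K8, cell `bsd-potss`), residual crux `PlusEtaMainConjectureNonsurj`
# (stmt-BirchSwinnertonDyer-19606): THE FUNCTIONAL EQUATION ON THE QUADRATIC BRANCH, XIX — ONE ZERO GIVES THE SHAPE: `μ = 0`, `λ = r + 2`,
# `ord_T = r` and ONE zero `t ≠ 0` of `L` in the open disc ⇒ `L = u·T^r·(T − t)(T − c₂)`, `u ∈ Λˣ`, `c₂ ∈ pℤ_p ∖ {0}` (the 19601 `hshape`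
# existential VERBATIM), and `c₂ = t^ι` by the functional equation; a HENSEL datum produces the zero (seat `bsd-potss-k8eta-c2` g29; kernel)

WHY. k8eta-c1's functional-equation squeeze for crux 19601 (`…PlusEtaLowerInclusionFunctionalEquationSqueeze`, g11) takes per pair the
ANALYTIC SHAPE `hshape`: `∃ u c₁ c₂, IsUnit u ∧ p ∣ c₁ ∧ p ∣ c₂ ∧ c₁ ≠ 0 ∧ c₂ ≠ 0 ∧ Lη = u·T^r·(T − c₁)(T − c₂)` ("a finite `p`-adic
computation per pair: `μ(Lη) = 0`, `λ(Lη) = r + 2`, the distinguished cofactor SPLITS with simple roots mod `p²` — Hensel"). Parts XV–XVIII of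
this series make that computation a THEOREM SCHEMA with the smallest possible input: (§49) from a Weierstrass datum `L = a·P·U` and
`coeff_j L = 0 (j < r)` the polynomial is `P = T^r·Q`, `Q` distinguished, `Q(0) ≠ 0` iff `coeff_r L ≠ 0`; (§50) a ZERO `t` of `L` in the open
disc (`evalHom t L = 0`, Part XV) is a root of `P` (`U(t) ∈ ℤ_pˣ`), and of `Q` if `t ≠ 0`; (§51) a monic quadratic with a root `t` is
`(T − t)(T − c₂)`, `c₂ = −q₁ − t` (Vieta); (§52) **THE SHAPE THEOREM: `L = P·U` (`μ = 0`), `deg P = r + 2`, `coeff_j L = 0 (j < r)`,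
`coeff_r L ≠ 0`, ONE zero `t ≠ 0`, `‖t‖ < 1` of `L` ⇒ the `hshape` existential with `c₁ = t`** — NO functional equation needed; with the
functional equation (Part XVII) the second zero is the PARTNER, `(1+t)(1+c₂) = 1`; (§53) tree currency `mu L = 0 ∧ lam L = r + 2`; (§54) the
zero from a HENSEL DATUM on `P` (Mathlib `hensels_lemma`): `‖P(a₀)‖ < ‖P'(a₀)‖² ∧ ‖P'(a₀)‖ ≤ ‖a₀‖ < 1 ⇒ ∃ t ≠ 0`, `‖t‖ < 1`, `L(t) = 0`;
(§55) at the rows of the crux / in 19601's binders. Everything here is about the analytic objects `L_p^±(V,η,X)`; B. D. Kim's Thm. 3.11, Kato's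
divisibility and the algebraic factor of `p` of that road are untouched.

WHAT. §49 `polynomial_coeff_eq_zero_of_coeff_eq_zero`, `exists_eq_X_pow_mul_of_coeff_eq_zero`; §50 `evalHom_coe_polynomial`,
`eval_eq_zero_of_evalHom_eq_zero`; §51 `eq_mul_X_sub_C_of_eval_eq_zero` (Vieta); §52 **`feShape_of_weierstrass_of_zero`**,
`feShape_partner_of_invol_eq_of_zero`; §53 `feShape_of_mu_eq_zero_of_lam_of_zero`; §54 **`exists_zero_of_hensel`**, `feShape_of_hensel`; §55
`feShape_plus_row_of_zero` (19601's `hshape` disjunct-free, from `μ = 0`, `λ = r+2`, `ord_T = r`, one zero), `feShape_plus_row_of_hensel`.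

HONEST FRAMING (cell `bsd-potss`; FULL-BSD rank ≤ 1 programme, HUMAN RULING D-0036/D-0074): TOOL THEOREMS ONLY — no definition, no named
fact, no `sorry`, axioms standard; nothing about (A), (C1⁺_η), (E⁺_η), C-cc-1 or `BSD(W,p)` of any pair is claimed; no stub of 19606 (or
19601) is proved; the per-pair inputs (`μ`, `λ`, `ord_T`, a zero or a Hensel datum) are supplied here for NO pair; crux and route OPEN;
nothing booked. `--supports stmt-BirchSwinnertonDyer-19606`.

References: [Washington1997] §7.1 (Thm. 7.3); [MazurTateTeitelbaum1986Invent] §I.17; [GreenbergLNM1716] §5 (p. 181); [Kobayashi2003] Thm. 3.2;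
Hensel's lemma (Mathlib `hensels_lemma`, K. Conrad's exposition). Tree: Parts XV–XVIII; `…PlusEtaLowerInclusionFunctionalEquationSqueeze` (`hshape`).
-/

set_option autoImplicit false
set_option linter.dupNamespace false
noncomputable section

open scoped Classical MatrixGroups ModularForm

open CongruenceSubgroup WeierstrassCurve Literature.NumberTheory.EllipticCurves
  Literature.NumberTheory.EllipticCurves.ModularForms
open Literature.NumberTheory.EllipticCurves.IwasawaAlgebra
open Summit.BirchSwinnertonDyer.Rank1Residual.Additive
open Summit.BirchSwinnertonDyer.Rank1Residual.X1.MuLambda (mu lam red pfree eq_C_pow_mu_mul_pfree red_pfree_ne_zero)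

namespace Summit.BirchSwinnertonDyer.BirchSwinnertonDyer.Theorems.EtaThetaFunctionalEquation

variable {p : ℕ} [hp : Fact p.Prime]

/-! ## §49 `coeff_j L = 0 (j < r)` ⇒ `P = T^r · Q` for a Weierstrass datum `L = a·P·U` -/

/-- If `L = a·P·U` with `a ≠ 0`, `U ∈ Λˣ` and `coeff_j L = 0` for `j < r`, then `coeff_j P = 0` for `j < r` (`T` is prime to `a` and to `U`:
induction on `j`, the lowest nonzero coefficient of `P` would show in `L`). [cite: Washington1997, §7.1] -/
theorem polynomial_coeff_eq_zero_of_coeff_eq_zero {P : Polynomial ℤ_[p]} {a : ℤ_[p]} (ha : a ≠ 0) {U : IwasawaAlgebra p} (hU : IsUnit U)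
    {L : IwasawaAlgebra p} (hL : L = PowerSeries.C a * (P : IwasawaAlgebra p) * U) {r : ℕ}
    (hz : ∀ j, j < r → PowerSeries.coeff j L = 0) : ∀ j, j < r → P.coeff j = 0 := by
  have hU0 : PowerSeries.constantCoeff U ≠ 0 := (PowerSeries.isUnit_iff_constantCoeff.mp hU).ne_zero
  intro j
  induction j using Nat.strong_induction_on with
  | _ j ih =>
    intro hj
    have h := hz j hj
    rw [hL, mul_assoc, PowerSeries.coeff_C_mul, PowerSeries.coeff_mul] at h
    -- the antidiagonal sum reduces to the term `(j, 0)`: lower `P`-coefficients vanish by induction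
    rw [Finset.sum_eq_single (j, 0)] at h
    · rw [Polynomial.coeff_coe, PowerSeries.coeff_zero_eq_constantCoeff] at h
      rcases mul_eq_zero.mp h with h1 | h1
      · exact absurd h1 ha
      · rcases mul_eq_zero.mp h1 with h2 | h2
        · exact h2
        · exact absurd h2 hU0
    · intro x hx hne
      have hsum : x.1 + x.2 = j := Finset.HasAntidiagonal.mem_antidiagonal.mp hx
      have hx1 : x.1 < j := by
        rcases Nat.lt_or_ge x.1 j with h1 | h1
        · exact h1
        · exfalso; apply hne; exact Prod.ext (by simp only; omega) (by simp only; omega)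
      rw [Polynomial.coeff_coe, ih x.1 hx1 (by omega), zero_mul]
    · intro hmem; exact absurd (Finset.HasAntidiagonal.mem_antidiagonal.mpr (by simp)) hmem

/-- **`P = T^r · Q`** with `Q` distinguished of degree `deg P − r` and `Q(0) = coeff_r P`, under the same hypotheses (`r ≤ deg P`).
[cite: Washington1997, §7.1] -/
theorem exists_eq_X_pow_mul_of_coeff_eq_zero {P : Polynomial ℤ_[p]} (hP : P.IsDistinguishedAt (IsLocalRing.maximalIdeal ℤ_[p]))
    {a : ℤ_[p]} (ha : a ≠ 0) {U : IwasawaAlgebra p} (hU : IsUnit U) {L : IwasawaAlgebra p}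
    (hL : L = PowerSeries.C a * (P : IwasawaAlgebra p) * U) {r : ℕ} (hz : ∀ j, j < r → PowerSeries.coeff j L = 0) :
    ∃ Q : Polynomial ℤ_[p], P = Polynomial.X ^ r * Q ∧ Q.IsDistinguishedAt (IsLocalRing.maximalIdeal ℤ_[p]) ∧
      Q.natDegree + r = P.natDegree ∧ Q.coeff 0 = P.coeff r := by
  obtain ⟨Q, hQ⟩ := Polynomial.X_pow_dvd_iff.mpr (polynomial_coeff_eq_zero_of_coeff_eq_zero ha hU hL hz)
  have hQ0 : Q ≠ 0 := by rintro rfl; exact hP.monic.ne_zero (by rw [hQ, mul_zero])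
  have hdeg : (Polynomial.X ^ r * Q).natDegree = Q.natDegree + r := Polynomial.natDegree_X_pow_mul (n := r) hQ0
  have hQmon : Q.Monic := (Polynomial.monic_X_pow r).of_mul_monic_left (hQ ▸ hP.monic)
  refine ⟨Q, hQ, { monic := hQmon, mem := fun {n} hn ↦ ?_ }, by rw [← hdeg, ← hQ],
    by rw [hQ, Polynomial.coeff_X_pow_mul', if_pos le_rfl, Nat.sub_self]⟩
  have h := hP.mem (show n + r < P.natDegree by rw [hQ, hdeg]; omega)
  rwa [hQ, Polynomial.coeff_X_pow_mul] at h

/-! ## §50 A zero of `L` in the open disc is a root of `P` (and of `Q` if nonzero) -/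

omit hp in
/-- On (coerced) polynomials `evalHom` is polynomial evaluation. [folklore] -/
theorem evalHom_coe_polynomial [Fact p.Prime] {t : ℤ_[p]} (ht : ‖t‖ < 1) (P : Polynomial ℤ_[p]) :
    evalHom t ht (P : IwasawaAlgebra p) = P.eval t := by
  rw [evalHom_apply, PowerSeries.eval₂_coe, Polynomial.eval₂_id]

/-- **A zero of `L = a·P·U` in the open disc is a root of `P`** (`a ≠ 0`, `U(t) ∈ ℤ_pˣ`). [cite: Washington1997, §7.1] -/
theorem eval_eq_zero_of_evalHom_eq_zero {P : Polynomial ℤ_[p]} {a : ℤ_[p]} (ha : a ≠ 0) {U : IwasawaAlgebra p} (hU : IsUnit U)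
    {L : IwasawaAlgebra p} (hL : L = PowerSeries.C a * (P : IwasawaAlgebra p) * U) {t : ℤ_[p]} (ht : ‖t‖ < 1)
    (h0 : evalHom t ht L = 0) : P.eval t = 0 := by
  rw [hL, map_mul, map_mul, evalHom_C_eq ht, evalHom_coe_polynomial ht] at h0
  rcases mul_eq_zero.mp h0 with h1 | h1
  · rcases mul_eq_zero.mp h1 with h2 | h2
    · exact absurd h2 ha
    · exact h2
  · exact absurd h1 (hU.map (evalHom t ht)).ne_zero

/-! ## §51 Vieta: a monic quadratic with a root `t` is `(T − t)(T − c₂)`, `c₂ = −q₁ − t` -/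

omit hp in
/-- **Vieta.** A monic quadratic `Q = T² + q₁T + q₀` with `Q(t) = 0` factors as `(T − t)(T − c₂)` with `c₂ = −q₁ − t` and `t·c₂ = q₀`. [folklore] -/
theorem eq_mul_X_sub_C_of_eval_eq_zero [Fact p.Prime] {Q : Polynomial ℤ_[p]} (hmon : Q.Monic) (hdeg : Q.natDegree = 2) {t : ℤ_[p]}
    (ht : Q.eval t = 0) :
    Q = (Polynomial.X - Polynomial.C t) * (Polynomial.X - Polynomial.C (-Q.coeff 1 - t)) ∧ t * (-Q.coeff 1 - t) = Q.coeff 0 := by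
  have hQ : Q = Polynomial.X ^ 2 + Polynomial.C (Q.coeff 1) * Polynomial.X + Polynomial.C (Q.coeff 0) := by
    conv_lhs => rw [hmon.as_sum, hdeg]
    simp only [Finset.sum_range_succ, Finset.sum_range_zero, zero_add, pow_zero, mul_one, pow_one]
    ring
  have hev : t ^ 2 + Q.coeff 1 * t + Q.coeff 0 = 0 := by
    rw [hQ, Polynomial.eval_add, Polynomial.eval_add, Polynomial.eval_pow, Polynomial.eval_X, Polynomial.eval_mul, Polynomial.eval_C,
      Polynomial.eval_X, Polynomial.eval_C] at ht
    exact ht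
  have hv : t * (-Q.coeff 1 - t) = Q.coeff 0 := by linear_combination -hev
  refine ⟨?_, hv⟩
  conv_lhs => rw [hQ]
  rw [map_sub, map_neg, ← hv, map_mul, map_sub, map_neg]
  ring

/-! ## §52 THE SHAPE THEOREM: one zero gives `L = u·T^r·(T − t)(T − c₂)` -/

/-- **ONE ZERO GIVES THE SHAPE.** If `L = P·U` (`P` distinguished — i.e. `μ(L) = 0` — of degree `r + 2`, `U ∈ Λˣ`), `coeff_j L = 0` for
`j < r`, `coeff_r L ≠ 0`, and `L(t) = 0` for ONE `t ≠ 0` of the open disc, then `L = u·T^r·(T − t)(T − c₂)` with `u = U ∈ Λˣ`,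
`t, c₂ ∈ pℤ_p ∖ {0}` — the 19601 `hshape` existential (with `c₁ = t`). No functional equation is used. [cite: Washington1997, §7.1 (Thm. 7.3)] -/
theorem feShape_of_weierstrass_of_zero {P : Polynomial ℤ_[p]} (hP : P.IsDistinguishedAt (IsLocalRing.maximalIdeal ℤ_[p]))
    {U : IwasawaAlgebra p} (hU : IsUnit U) {L : IwasawaAlgebra p} (hL : L = (P : IwasawaAlgebra p) * U) {r : ℕ}
    (hdeg : P.natDegree = r + 2) (hz : ∀ j, j < r → PowerSeries.coeff j L = 0) (hr : PowerSeries.coeff r L ≠ 0)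
    {t : ℤ_[p]} (ht : ‖t‖ < 1) (ht0 : t ≠ 0) (hLt : evalHom t ht L = 0) :
    ∃ (u : IwasawaAlgebra p) (c₁ c₂ : ℤ_[p]), IsUnit u ∧ (p : ℤ_[p]) ∣ c₁ ∧ (p : ℤ_[p]) ∣ c₂ ∧ c₁ ≠ 0 ∧ c₂ ≠ 0 ∧
      L = u * PowerSeries.X ^ r * ((PowerSeries.X - PowerSeries.C c₁) * (PowerSeries.X - PowerSeries.C c₂)) := by
  have hL1 : L = PowerSeries.C 1 * (P : IwasawaAlgebra p) * U := by rw [map_one, one_mul, hL]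
  obtain ⟨Q, hPQ, hQ, hQdeg, hQ0⟩ := exists_eq_X_pow_mul_of_coeff_eq_zero hP one_ne_zero hU hL1 hz
  have hQ2 : Q.natDegree = 2 := by omega
  -- `t` is a root of `P`, hence of `Q`
  have hPt : P.eval t = 0 := eval_eq_zero_of_evalHom_eq_zero one_ne_zero hU hL1 ht hLt
  have hQt : Q.eval t = 0 := by
    rw [hPQ, Polynomial.eval_mul, Polynomial.eval_pow, Polynomial.eval_X] at hPt
    rcases mul_eq_zero.mp hPt with h | h
    · exact absurd (pow_eq_zero_iff'.mp h).1 ht0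
    · exact h
  have hq1 : (p : ℤ_[p]) ∣ Q.coeff 1 := by
    rw [← Ideal.mem_span_singleton, ← PadicInt.maximalIdeal_eq_span_p]; exact hQ.mem (by omega)
  obtain ⟨hQfac, hv⟩ := eq_mul_X_sub_C_of_eval_eq_zero hQ.monic hQ2 hQt
  set c₂ : ℤ_[p] := -Q.coeff 1 - t with hc₂def
  have htp : (p : ℤ_[p]) ∣ t := (PadicInt.norm_lt_one_iff_dvd t).mp ht
  have hc₂p : (p : ℤ_[p]) ∣ c₂ := by rw [hc₂def]; exact (hq1.neg_right).sub htp
  -- `coeff_r L = Q(0)·U(0) ≠ 0` ⇒ `c₂ ≠ 0`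
  have hc2 : c₂ ≠ 0 := by
    intro h0
    apply hr
    rw [hL, hPQ, coe_X_pow_mul, mul_assoc, PowerSeries.coeff_X_pow_mul', if_pos le_rfl, Nat.sub_self, PowerSeries.coeff_mul,
      Finset.Nat.antidiagonal_zero, Finset.sum_singleton, Polynomial.coeff_coe, ← hv, h0, mul_zero, zero_mul]
  refine ⟨U, t, c₂, hU, htp, hc₂p, ht0, hc2, ?_⟩
  rw [hL, hPQ, coe_X_pow_mul, hQfac, Polynomial.coe_mul, Polynomial.coe_sub, Polynomial.coe_sub, Polynomial.coe_X, Polynomial.coe_C,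
    Polynomial.coe_C]
  ring

/-- **… AND THE SECOND ZERO IS THE PARTNER** when `L` satisfies an exact functional equation `ι L = w·(1+T)^e·L`, `w = ±1` (`p` odd): then
additionally `(1 + t)(1 + c₂) = 1` (Part XVII `partners_of_invol_eq_of_shape`). [cite: GreenbergLNM1716, §5 (p. 181)]
[cite: MazurTateTeitelbaum1986Invent, §I.17] -/
theorem feShape_partner_of_invol_eq_of_zero (hp2 : p ≠ 2) {P : Polynomial ℤ_[p]}
    (hP : P.IsDistinguishedAt (IsLocalRing.maximalIdeal ℤ_[p])) {U : IwasawaAlgebra p} (hU : IsUnit U) {L : IwasawaAlgebra p}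
    (hL : L = (P : IwasawaAlgebra p) * U) {r : ℕ} (hdeg : P.natDegree = r + 2) (hz : ∀ j, j < r → PowerSeries.coeff j L = 0)
    (hr : PowerSeries.coeff r L ≠ 0) {t : ℤ_[p]} (ht : ‖t‖ < 1) (ht0 : t ≠ 0) (hLt : evalHom t ht L = 0) {w e : ℤ_[p]}
    (hw : w = 1 ∨ w = -1) (hFE : invol p L = PowerSeries.C w * PowerSeries.binomialSeries ℤ_[p] e * L) :
    ∃ (u : IwasawaAlgebra p) (c₂ : ℤ_[p]), IsUnit u ∧ (p : ℤ_[p]) ∣ t ∧ (p : ℤ_[p]) ∣ c₂ ∧ c₂ ≠ 0 ∧ (1 + t) * (1 + c₂) = 1 ∧ w = (-1) ^ r ∧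
      L = u * PowerSeries.X ^ r * ((PowerSeries.X - PowerSeries.C t) * (PowerSeries.X - PowerSeries.C c₂)) := by
  obtain ⟨u, c₁, c₂, hu, hc₁, hc₂, -, hc₂0, hLs⟩ := feShape_of_weierstrass_of_zero hP hU hL hdeg hz hr ht ht0 hLt
  -- in the proof above `c₁ = t`; recover it from the statement: `t` is a zero, so `t ∈ {0, c₁, c₂}`… simpler: redo with the explicit witnesses
  obtain ⟨h1, hw'⟩ := partners_of_invol_eq_of_shape hp2 hu hc₁ hc₂ hLs hw hFE
  -- `t` is a zero of `L = u T^r (T−c₁)(T−c₂)`: `u(t) t^r (t−c₁)(t−c₂) = 0` ⇒ `t = c₁ ∨ t = c₂`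
  have hzero : (t - c₁) * (t - c₂) = 0 := by
    have h := hLt
    rw [hLs, map_mul, map_mul, map_mul, map_pow, map_sub, map_sub, evalHom_X_eq ht, evalHom_C_eq ht, evalHom_C_eq ht] at h
    rcases mul_eq_zero.mp h with h' | h'
    · rcases mul_eq_zero.mp h' with h'' | h''
      · exact absurd h'' (hu.map (evalHom t ht)).ne_zero
      · exact absurd (pow_eq_zero_iff'.mp h'').1 ht0
    · exact h'
  rcases mul_eq_zero.mp hzero with h | h
  · have htc : t = c₁ := by linear_combination h
    subst htc
    exact ⟨u, c₂, hu, hc₁, hc₂, hc₂0, h1, hw', hLs⟩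
  · have htc : t = c₂ := by linear_combination h
    subst htc
    refine ⟨u, c₁, hu, hc₂, hc₁, ?_, by rw [mul_comm]; exact h1, hw', by rw [hLs]; ring⟩
    rintro rfl
    -- `c₁ = 0` contradicts `(1+c₁)(1+t) = 1` with `t ≠ 0`
    apply ht0; linear_combination h1

/-! ## §53 Tree currency: `μ(L) = 0`, `λ(L) = r + 2` -/

/-- **THE SHAPE FROM `μ(L) = 0`, `λ(L) = r + 2`, `ord_T L = r` AND ONE ZERO** (tree `X1.MuLambda.mu` / `lam`; the Weierstrass datum of the
`p`-free part `L` itself by Mathlib's Weierstrass preparation). [cite: Washington1997, §7.1 (Thm. 7.3)] -/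
theorem feShape_of_mu_eq_zero_of_lam_of_zero {L : IwasawaAlgebra p} (hL0 : L ≠ 0) (hmu : mu L = 0) {r : ℕ} (hlam : lam L = r + 2)
    (hz : ∀ j, j < r → PowerSeries.coeff j L = 0) (hr : PowerSeries.coeff r L ≠ 0)
    {t : ℤ_[p]} (ht : ‖t‖ < 1) (ht0 : t ≠ 0) (hLt : evalHom t ht L = 0) :
    ∃ (u : IwasawaAlgebra p) (c₁ c₂ : ℤ_[p]), IsUnit u ∧ (p : ℤ_[p]) ∣ c₁ ∧ (p : ℤ_[p]) ∣ c₂ ∧ c₁ ≠ 0 ∧ c₂ ≠ 0 ∧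
      L = u * PowerSeries.X ^ r * ((PowerSeries.X - PowerSeries.C c₁) * (PowerSeries.X - PowerSeries.C c₂)) := by
  obtain ⟨P, U, hP, hU, hdeg, hLP⟩ := exists_weierstrass_of_ne_zero hL0
  rw [hmu, pow_zero, map_one, one_mul] at hLP
  exact feShape_of_weierstrass_of_zero hP hU hLP (hdeg.trans hlam) hz hr ht ht0 hLt

/-! ## §54 The zero from a Hensel datum on the Weierstrass polynomial -/

/-- **A HENSEL DATUM PRODUCES THE ZERO.** `L = a·P·U` (`a ≠ 0`, `U ∈ Λˣ`), `a₀ ∈ ℤ_p` with `‖P(a₀)‖ < ‖P'(a₀)‖²` and `‖P'(a₀)‖ ≤ ‖a₀‖ < 1`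
⇒ there is `t ≠ 0` in the open disc with `L(t) = 0` (Mathlib `hensels_lemma`: the root `t` has `‖t − a₀‖ < ‖P'(a₀)‖ ≤ ‖a₀‖`, so `t ≠ 0` and
`‖t‖ < 1`). [cite: Washington1997, §7.1] -/
theorem exists_zero_of_hensel {P : Polynomial ℤ_[p]} {a : ℤ_[p]} {U : IwasawaAlgebra p} {L : IwasawaAlgebra p}
    (hL : L = PowerSeries.C a * (P : IwasawaAlgebra p) * U) {a₀ : ℤ_[p]} (ha₀ : ‖a₀‖ < 1)
    (hnorm : ‖P.eval a₀‖ < ‖P.derivative.eval a₀‖ ^ 2) (hder : ‖P.derivative.eval a₀‖ ≤ ‖a₀‖) :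
    ∃ (t : ℤ_[p]) (ht : ‖t‖ < 1), t ≠ 0 ∧ evalHom t ht L = 0 := by
  have hnorm' : ‖Polynomial.aeval a₀ P‖ < ‖Polynomial.aeval a₀ (Polynomial.derivative P)‖ ^ 2 := by
    rwa [Polynomial.coe_aeval_eq_eval]
  obtain ⟨z, hz, hza, -, -⟩ := hensels_lemma hnorm'
  rw [Polynomial.coe_aeval_eq_eval] at hz hza
  have hza' : ‖z - a₀‖ < ‖a₀‖ := hza.trans_le hder
  have hz1 : ‖z‖ < 1 := by
    have h := PadicInt.nonarchimedean (z - a₀) a₀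
    rw [sub_add_cancel] at h
    exact h.trans_lt (max_lt (hza'.trans ha₀) ha₀)
  have hz0 : z ≠ 0 := by
    rintro rfl
    rw [zero_sub, norm_neg] at hza'
    exact lt_irrefl _ hza'
  refine ⟨z, hz1, hz0, ?_⟩
  rw [hL, map_mul, map_mul, evalHom_coe_polynomial hz1, hz, mul_zero, zero_mul]

/-- **`hshape` FROM A HENSEL DATUM (generic)**: `L = P·U` (`P` distinguished of degree `r + 2`, `U ∈ Λˣ`), `coeff_j L = 0 (j < r)`,
`coeff_r L ≠ 0`, `‖P(a₀)‖ < ‖P'(a₀)‖² ∧ ‖P'(a₀)‖ ≤ ‖a₀‖ < 1` ⇒ `∃ u c₁ c₂, …` (no functional equation). [cite: Washington1997, §7.1 (Thm. 7.3)] -/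
theorem feShape_of_hensel {P : Polynomial ℤ_[p]} (hP : P.IsDistinguishedAt (IsLocalRing.maximalIdeal ℤ_[p]))
    {U : IwasawaAlgebra p} (hU : IsUnit U) {L : IwasawaAlgebra p} (hL : L = (P : IwasawaAlgebra p) * U) {r : ℕ}
    (hdeg : P.natDegree = r + 2) (hz : ∀ j, j < r → PowerSeries.coeff j L = 0) (hr : PowerSeries.coeff r L ≠ 0)
    {a₀ : ℤ_[p]} (ha₀ : ‖a₀‖ < 1) (hnorm : ‖P.eval a₀‖ < ‖P.derivative.eval a₀‖ ^ 2) (hder : ‖P.derivative.eval a₀‖ ≤ ‖a₀‖) :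
    ∃ (u : IwasawaAlgebra p) (c₁ c₂ : ℤ_[p]), IsUnit u ∧ (p : ℤ_[p]) ∣ c₁ ∧ (p : ℤ_[p]) ∣ c₂ ∧ c₁ ≠ 0 ∧ c₂ ≠ 0 ∧
      L = u * PowerSeries.X ^ r * ((PowerSeries.X - PowerSeries.C c₁) * (PowerSeries.X - PowerSeries.C c₂)) := by
  have hL1 : L = PowerSeries.C 1 * (P : IwasawaAlgebra p) * U := by rw [map_one, one_mul, hL]
  obtain ⟨t, ht, ht0, hLt⟩ := exists_zero_of_hensel hL1 ha₀ hnorm hder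
  exact feShape_of_weierstrass_of_zero hP hU hL hdeg hz hr ht ht0 hLt

/-! ## §55 On the quadratic branch: the 19601 `hshape` from `μ = 0`, `λ = r + 2`, `ord_T = r` and one zero / a Hensel datum -/

section Row

variable {N : ℕ} [NeZero N] {f : CuspForm (Gamma0 N) 2}

/-- **AT A ROW (plus): `hshape` WITH THE PARTNER.** `V` globally minimal, good at `p ≥ 5`, `a_p(V) = 0`, `f` its newform, any `ϖ`, a plus
branch function `Lη = P·U` (`P` distinguished of degree `r + 2`, `U ∈ Λˣ`), `coeff_j Lη = 0 (j < r)`, `coeff_r Lη ≠ 0`, ONE zero `t ≠ 0` of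
the open disc: `Lη = u·T^r·(T − t)(T − c₂)` with `u ∈ Λˣ`, `c₂ ∈ pℤ_p ∖ {0}`, `(1+t)(1+c₂) = 1`. Hypothesis-free beyond the row data and
the displayed inputs. [cite: Washington1997, §7.1 (Thm. 7.3)] [cite: GreenbergLNM1716, §5 (p. 181)] [cite: Kobayashi2003, Thm. 3.2, (3.4)] -/
theorem feShape_plus_row_of_zero (hp5 : 5 ≤ p) (V : WeierstrassCurve ℚ) [V.IsElliptic] [V.IsGloballyMinimal]
    (hgood : V.HasGoodReductionAtPrime p) (hap : V.frobeniusTrace p = 0) (hf : IsNewformOf V f) (ϖ : ℚ) {Lη : IwasawaAlgebra p}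
    (hL : IsQuadraticBranchPlusLFunction f p ϖ Lη) {P : Polynomial ℤ_[p]} (hP : P.IsDistinguishedAt (IsLocalRing.maximalIdeal ℤ_[p]))
    {U : IwasawaAlgebra p} (hU : IsUnit U) (hLP : Lη = (P : IwasawaAlgebra p) * U) {r : ℕ} (hdeg : P.natDegree = r + 2)
    (hz : ∀ j, j < r → PowerSeries.coeff j Lη = 0) (hr : PowerSeries.coeff r Lη ≠ 0)
    {t : ℤ_[p]} (ht : ‖t‖ < 1) (ht0 : t ≠ 0) (hLt : evalHom t ht Lη = 0) :
    ∃ (u : IwasawaAlgebra p) (c₂ : ℤ_[p]), IsUnit u ∧ (p : ℤ_[p]) ∣ t ∧ (p : ℤ_[p]) ∣ c₂ ∧ c₂ ≠ 0 ∧ (1 + t) * (1 + c₂) = 1 ∧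
      Lη = u * PowerSeries.X ^ r * ((PowerSeries.X - PowerSeries.C t) * (PowerSeries.X - PowerSeries.C c₂)) := by
  have hp2 : p ≠ 2 := by omega
  have hap' : cuspCoeff f p = ((0 : ℤ) : ℂ) := by
    rw [cuspCoeff_eq_frobeniusTrace_of_isNewformOf_holds hf hgood, hap]
  have hpN := not_dvd_level_of_isNewformOf hf hgood
  obtain ⟨σ, hσ, hW⟩ := exists_frickeSign_of_isNewform0 hf.1
  obtain ⟨e, he⟩ := exists_invol_eq_of_isQuadraticBranchPlusLFunction hp2 hf.1 hf.coeffField_eq_bot hpN hap' hσ hW hL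
  have hw : (((σ * legendreSym p (-(N : ℤ)) : ℤ) : ℤ_[p])) = 1 ∨ (((σ * legendreSym p (-(N : ℤ)) : ℤ) : ℤ_[p])) = -1 := by
    rcases sign_eq_one_or hpN hσ with h | h <;> rw [h] <;> simp
  obtain ⟨u, c₂, hu, htp, hc₂, hc₂0, h1, -, hLs⟩ :=
    feShape_partner_of_invol_eq_of_zero hp2 hP hU hLP hdeg hz hr ht ht0 hLt hw he
  exact ⟨u, c₂, hu, htp, hc₂, hc₂0, h1, hLs⟩

/-- **AT A ROW (plus): `hshape` FROM A HENSEL DATUM** — `Lη = P·U` as above, `coeff_j Lη = 0 (j < r)`, `coeff_r Lη ≠ 0`, and `a₀` with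
`‖P(a₀)‖ < ‖P'(a₀)‖² ∧ ‖P'(a₀)‖ ≤ ‖a₀‖ < 1` ⇒ the 19601 `hshape` existential (`∃ u c₁ c₂, …`) WITH the partner relation
`(1+c₁)(1+c₂) = 1`. [cite: Washington1997, §7.1 (Thm. 7.3)] [cite: GreenbergLNM1716, §5 (p. 181)] [cite: Kobayashi2003, Thm. 3.2, (3.4)] -/
theorem feShape_plus_row_of_hensel (hp5 : 5 ≤ p) (V : WeierstrassCurve ℚ) [V.IsElliptic] [V.IsGloballyMinimal]
    (hgood : V.HasGoodReductionAtPrime p) (hap : V.frobeniusTrace p = 0) (hf : IsNewformOf V f) (ϖ : ℚ) {Lη : IwasawaAlgebra p}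
    (hL : IsQuadraticBranchPlusLFunction f p ϖ Lη) {P : Polynomial ℤ_[p]} (hP : P.IsDistinguishedAt (IsLocalRing.maximalIdeal ℤ_[p]))
    {U : IwasawaAlgebra p} (hU : IsUnit U) (hLP : Lη = (P : IwasawaAlgebra p) * U) {r : ℕ} (hdeg : P.natDegree = r + 2)
    (hz : ∀ j, j < r → PowerSeries.coeff j Lη = 0) (hr : PowerSeries.coeff r Lη ≠ 0)
    {a₀ : ℤ_[p]} (ha₀ : ‖a₀‖ < 1) (hnorm : ‖P.eval a₀‖ < ‖P.derivative.eval a₀‖ ^ 2) (hder : ‖P.derivative.eval a₀‖ ≤ ‖a₀‖) :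
    ∃ (u : IwasawaAlgebra p) (c₁ c₂ : ℤ_[p]), IsUnit u ∧ (p : ℤ_[p]) ∣ c₁ ∧ (p : ℤ_[p]) ∣ c₂ ∧ c₁ ≠ 0 ∧ c₂ ≠ 0 ∧
      (1 + c₁) * (1 + c₂) = 1 ∧
      Lη = u * PowerSeries.X ^ r * ((PowerSeries.X - PowerSeries.C c₁) * (PowerSeries.X - PowerSeries.C c₂)) := by
  have hL1 : Lη = PowerSeries.C 1 * (P : IwasawaAlgebra p) * U := by rw [map_one, one_mul, hLP]
  obtain ⟨t, ht, ht0, hLt⟩ := exists_zero_of_hensel hL1 ha₀ hnorm hder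
  obtain ⟨u, c₂, hu, htp, hc₂, hc₂0, h1, hLs⟩ := feShape_plus_row_of_zero hp5 V hgood hap hf ϖ hL hP hU hLP hdeg hz hr ht ht0 hLt
  exact ⟨u, t, c₂, hu, htp, hc₂, ht0, hc₂0, h1, hLs⟩

end Row

end Summit.BirchSwinnertonDyer.BirchSwinnertonDyer.Theorems.EtaThetaFunctionalEquation

end
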